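import Literature.Analysis.SpecialFunctions.DigammaVerticalSeries
import Mathlib.Analysis.SpecialFunctions.Trigonometric.ArctanDeriv
import Mathlib.Analysis.Convex.Deriv
import Mathlib.Analysis.Calculus.Deriv.MeanValue

/-!
# The digamma integral `∫_0^T Re ψ(1/4 + it/2) dt` by convexity (Jensen / Hermite–Hadamard)

Helper for stub `stub_archBathtub` of line `Sketch`, crux `WeilComb.CombShapePositivity`
(item stmt-RiemannHypothesis-11229, route route-RiemannHypothesis-WeilComb), siege attempt k3 —
variation CONVEXITY / JENSEN; consumed by `WeilCombCombShapePositivityStubArchBathtubK3.lean`.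

Main result (`integral_reDigammaQuarter_half_ge`): for `T ≥ 2`,
`T (log(T/2) − 1) − 21/5 ≤ Φ(T) = ∫_0^T ρ`, `ρ(t) = Re ψ(1/4 + it/2)` (`reDigammaQuarter`).
The proof is independent of the Stirling formula for `arg Γ` (lead's proof of the stub) and of the
pointwise second-order Stirling bound for `Re ψ` (attempt k4); it uses only Yoshida's vertical
series, the real first-order Stirling bound at ONE real point, and Jensen's inequality:

* `ρ(t) ≥ ψ(1/4) + Σ_{m<K} f_{l_m}(t)`, `f_l(t) = 2t²/(l(l²+t²)) = 2/l − 2l/(l²+t²)`, `l_m = 2m + 1/2`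
  (`sum_digammaTerm_le`), and `∫_0^T f_l = 2T/l − 2 arctan(T/l)`; hence for every `K`
  `Φ(T) ≥ T ψ(K + 1/4) − 2 Σ_{m<K} arctan(T/l_m)` (`ψ(1/4) + Σ_{m<K} 1/(m + 1/4) = ψ(K + 1/4)`,
  `re_digamma_add_nat`).
* JENSEN: `l ↦ arctan(T/l)` is convex on `(0, ∞)` (its derivative `−T/(l²+T²)` is increasing), so
  its value at the midpoint `l_m` of the cell `[l_m − 1, l_m + 1]` is at most its average over the
  cell (Hermite–Hadamard); the cells `m = 1, …, K−1` tile `[3/2, 2K − 1/2]` and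
  `∫ arctan(T/l) dl = A(l) := l arctan(T/l) + (T/2) log(l² + T²)`, so
  `2 Σ_{1 ≤ m < K} arctan(T/l_m) ≤ A(2K − 1/2) − A(3/2)`; the cell `m = 0` costs at most `π`.
* With `ψ(x) ≥ log x − 1/(2x) − 1/(12x²)` at `x = K + 1/4` (`Real.log_sub_le_re_digamma`),
  `arctan y ≤ y`, `log(1 + y) ≤ y`, `arctan(4/3) ≥ π/4`, `π ≤ 4` and ANY `K ≥ T³`, everything
  collapses to `Φ(T) ≥ T log(T/2) − T − 5π/8 − 5/16 ≥ T (log(T/2) − 1) − 21/5`.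
-/

noncomputable section

-- the sub-problem path RiemannHypothesis/RiemannHypothesis duplicates a namespace (D-0017)
set_option linter.dupNamespace false

open scoped BigOperators
open MeasureTheory Set

namespace Summit.RiemannHypothesis.RiemannHypothesis.Theorems.WeilCombBohrFejerJensenK3

open Literature.Analysis.SpecialFunctions (reDigammaQuarter reDigammaQuarter_zero
  continuous_reDigammaQuarter digammaTerm digammaNode digammaNode_pos digammaTerm_eq
  sum_digammaTerm_le re_digamma_add_nat)

/-! ### Elementary facts on `l ↦ arctan(T/l)` -/

/-- The derivative of `l ↦ arctan(T/l)` at `l > 0` is `−T/(l² + T²)`. [folklore] -/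
theorem hasDerivAt_arctan_div (T : ℝ) {l : ℝ} (hl : 0 < l) :
    HasDerivAt (fun l : ℝ ↦ Real.arctan (T / l)) (-T / (l ^ 2 + T ^ 2)) l := by
  refine (((hasDerivAt_const l T).fun_div (hasDerivAt_id' l) hl.ne').arctan).congr_deriv ?_
  have hl2 : 0 < l ^ 2 + T ^ 2 := by positivity
  field_simp
  ring

/-- The antiderivative of `l ↦ arctan(T/l)` on `l > 0`:
`A(l) = l arctan(T/l) + (T/2) log(l² + T²)`, `A' = arctan(T/·)`. [folklore] -/
theorem hasDerivAt_arctanPrim (T : ℝ) {l : ℝ} (hl : 0 < l) :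
    HasDerivAt (fun l : ℝ ↦ l * Real.arctan (T / l) + T / 2 * Real.log (l ^ 2 + T ^ 2))
      (Real.arctan (T / l)) l := by
  have hpos : 0 < l ^ 2 + T ^ 2 := by positivity
  have h1 := (hasDerivAt_id' l).fun_mul (hasDerivAt_arctan_div T hl)
  have h2 : HasDerivAt (fun l : ℝ ↦ l ^ 2 + T ^ 2) (2 * l) l := by
    simpa using (hasDerivAt_pow 2 l).add_const (T ^ 2)
  have h3 := (h2.log hpos.ne').const_mul (T / 2)
  refine (h1.fun_add h3).congr_deriv ?_
  field_simp
  ring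

/-- `∫_a^b arctan(T/l) dl = A(b) − A(a)` for `a, b > 0`. [folklore] -/
theorem integral_arctan_div (T : ℝ) {a b : ℝ} (ha : 0 < a) (hb : 0 < b) :
    ∫ l in a..b, Real.arctan (T / l) =
      (b * Real.arctan (T / b) + T / 2 * Real.log (b ^ 2 + T ^ 2)) -
        (a * Real.arctan (T / a) + T / 2 * Real.log (a ^ 2 + T ^ 2)) := by
  have hpos : ∀ x ∈ uIcc a b, 0 < x := by
    intro x hx
    rcases le_total a b with h | h
    · rw [uIcc_of_le h] at hx; exact ha.trans_le hx.1
    · rw [uIcc_of_ge h] at hx; exact hb.trans_le hx.1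
  refine intervalIntegral.integral_eq_sub_of_hasDerivAt (fun x hx ↦ hasDerivAt_arctanPrim T (hpos x hx))
    (ContinuousOn.intervalIntegrable fun x hx ↦ ?_)
  exact (hasDerivAt_arctan_div T (hpos x hx)).continuousAt.continuousWithinAt

/-- For `T ≥ 0`, `l ↦ arctan(T/l)` is CONVEX on `(0, ∞)`: its derivative `−T/(l² + T²)` is
increasing there. [folklore] -/
theorem convexOn_arctan_div {T : ℝ} (hT : 0 ≤ T) :
    ConvexOn ℝ (Ioi (0 : ℝ)) (fun l : ℝ ↦ Real.arctan (T / l)) := by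
  have hd : ∀ l ∈ Ioi (0 : ℝ),
      HasDerivAt (fun l : ℝ ↦ Real.arctan (T / l)) (-T / (l ^ 2 + T ^ 2)) l :=
    fun l hl ↦ hasDerivAt_arctan_div T hl
  refine MonotoneOn.convexOn_of_deriv (convex_Ioi 0)
    (fun l hl ↦ (hd l hl).continuousAt.continuousWithinAt) ?_ ?_
  · rw [interior_Ioi]
    exact fun l hl ↦ (hd l hl).differentiableAt.differentiableWithinAt
  · rw [interior_Ioi]
    intro a ha b hb hab
    have ha0 : (0 : ℝ) < a := ha
    rw [(hd a ha).deriv, (hd b hb).deriv, neg_div, neg_div, neg_le_neg_iff]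
    exact div_le_div_of_nonneg_left hT (by positivity) (by nlinarith)

/-! ### Jensen / Hermite–Hadamard at the midpoint -/

/-- **Jensen's inequality in Hermite–Hadamard form (midpoint half).** If `f` is convex on
`D ⊇ [c − 1, c + 1]` and continuous on `[c − 1, c + 1]`, then `2 f(c) ≤ ∫_{c−1}^{c+1} f`
(average the two-point inequality `f(c) ≤ (f(c−s) + f(c+s))/2` over `s ∈ [0, 1]`). [folklore] -/
theorem two_mul_le_integral_of_convexOn {f : ℝ → ℝ} {D : Set ℝ} {c : ℝ} (hf : ConvexOn ℝ D f)
    (hD : Icc (c - 1) (c + 1) ⊆ D) (hc : ContinuousOn f (Icc (c - 1) (c + 1))) :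
    2 * f c ≤ ∫ x in (c - 1)..(c + 1), f x := by
  have hi1 : IntervalIntegrable f volume (c - 1) c :=
    (hc.mono (Icc_subset_Icc_right (by linarith))).intervalIntegrable_of_Icc (by linarith)
  have hi2 : IntervalIntegrable f volume c (c + 1) :=
    (hc.mono (Icc_subset_Icc_left (by linarith))).intervalIntegrable_of_Icc (by linarith)
  rw [← intervalIntegral.integral_add_adjacent_intervals hi1 hi2]
  have hl : ∫ x in (c - 1)..c, f x = ∫ s in (0 : ℝ)..1, f (c - s) := by
    rw [intervalIntegral.integral_comp_sub_left f c]
    simp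
  have hr : ∫ x in c..(c + 1), f x = ∫ s in (0 : ℝ)..1, f (c + s) := by
    rw [intervalIntegral.integral_comp_add_left f c]
    simp
  have hcm : ContinuousOn (fun s : ℝ ↦ f (c - s)) (Icc 0 1) :=
    hc.comp (continuousOn_const.sub continuousOn_id)
      fun s hs ↦ ⟨by linarith [hs.2], by linarith [hs.1]⟩
  have hcp : ContinuousOn (fun s : ℝ ↦ f (c + s)) (Icc 0 1) :=
    hc.comp (continuousOn_const.add continuousOn_id)
      fun s hs ↦ ⟨by linarith [hs.1], by linarith [hs.2]⟩
  have him : IntervalIntegrable (fun s : ℝ ↦ f (c - s)) volume 0 1 :=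
    hcm.intervalIntegrable_of_Icc zero_le_one
  have hip : IntervalIntegrable (fun s : ℝ ↦ f (c + s)) volume 0 1 :=
    hcp.intervalIntegrable_of_Icc zero_le_one
  rw [hl, hr, ← intervalIntegral.integral_add him hip]
  have hconst : ∫ _ in (0 : ℝ)..1, 2 * f c = 2 * f c := by simp
  rw [← hconst]
  refine intervalIntegral.integral_mono_on zero_le_one intervalIntegrable_const (him.add hip)
    fun s hs ↦ ?_
  have hx : c - s ∈ D := hD ⟨by linarith [hs.2], by linarith [hs.1]⟩
  have hy : c + s ∈ D := hD ⟨by linarith [hs.1], by linarith [hs.2]⟩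
  have h := hf.2 hx hy (by norm_num : (0 : ℝ) ≤ 1 / 2) (by norm_num : (0 : ℝ) ≤ 1 / 2)
    (by norm_num)
  simp only [smul_eq_mul] at h
  have e : (1 / 2 : ℝ) * (c - s) + 1 / 2 * (c + s) = c := by ring
  rw [e] at h
  linarith

/-- **Jensen summed over Yoshida's cells.** For `T ≥ 0` and every `k`:
`Σ_{i<k} 2 arctan(T/l_{i+1}) ≤ A(l_{k+1} − 1) − A(3/2)`, `A(l) = l arctan(T/l) + (T/2) log(l²+T²)`
(the cells `[l_m − 1, l_m + 1]`, `m = 1..k`, tile `[3/2, l_{k+1} − 1]` inside `(0, ∞)`, where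
`arctan(T/·)` is convex). [folklore] -/
theorem sum_arctan_div_le {T : ℝ} (hT : 0 ≤ T) (k : ℕ) :
    ∑ i ∈ Finset.range k, 2 * Real.arctan (T / digammaNode (i + 1)) ≤
      ((digammaNode (k + 1) - 1) * Real.arctan (T / (digammaNode (k + 1) - 1)) +
          T / 2 * Real.log ((digammaNode (k + 1) - 1) ^ 2 + T ^ 2)) -
        (3 / 2 * Real.arctan (T / (3 / 2)) + T / 2 * Real.log ((3 / 2) ^ 2 + T ^ 2)) := by
  induction k with
  | zero =>
    have e : digammaNode (0 + 1) - 1 = 3 / 2 := by unfold digammaNode; push_cast; ring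
    rw [e]
    simp
  | succ k ih =>
    rw [Finset.sum_range_succ]
    have hl0 : 0 < digammaNode (k + 1) - 1 := by
      have hk : (0 : ℝ) ≤ k := Nat.cast_nonneg k
      unfold digammaNode; push_cast; linarith
    have hcell : 2 * Real.arctan (T / digammaNode (k + 1)) ≤
        ∫ l in (digammaNode (k + 1) - 1)..(digammaNode (k + 1) + 1), Real.arctan (T / l) := by
      refine two_mul_le_integral_of_convexOn (convexOn_arctan_div hT)
        (fun l hl ↦ ?_) (fun l hl ↦ ?_)
      · exact hl0.trans_le hl.1
      · exact (hasDerivAt_arctan_div T (hl0.trans_le hl.1)).continuousAt.continuousWithinAt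
    rw [integral_arctan_div T hl0 (by linarith)] at hcell
    have e : digammaNode (k + 1 + 1) - 1 = digammaNode (k + 1) + 1 := by
      unfold digammaNode; push_cast; ring
    rw [e]
    linarith

/-! ### Integrating the partial sums of the vertical series -/

/-- `∫_0^T f_l(t) dt = 2T/l − 2 arctan(T/l)` for `l > 0` (`f_l = 2/l − 2l/(l²+t²)`). [folklore] -/
theorem integral_digammaTerm {l : ℝ} (hl : 0 < l) (T : ℝ) :
    ∫ t in (0 : ℝ)..T, digammaTerm l t = 2 * T / l - 2 * Real.arctan (T / l) := by
  have hderiv : ∀ t : ℝ, HasDerivAt (fun t : ℝ ↦ 2 * t / l - 2 * Real.arctan (t / l))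
      (digammaTerm l t) t := by
    intro t
    have h1 : HasDerivAt (fun t : ℝ ↦ 2 * t / l) (2 / l) t := by
      simpa using ((hasDerivAt_id' t).const_mul 2).div_const l
    have h2 : HasDerivAt (fun t : ℝ ↦ t / l) (1 / l) t := by
      simpa using (hasDerivAt_id' t).div_const l
    have h3 := h2.arctan.const_mul 2
    refine (h1.fun_sub h3).congr_deriv ?_
    rw [digammaTerm_eq hl]
    have : 0 < l ^ 2 + t ^ 2 := by positivity
    field_simp
  have hcont : Continuous fun t : ℝ ↦ digammaTerm l t := by
    unfold digammaTerm
    refine Continuous.div (by fun_prop) (by fun_prop) fun t ↦ ?_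
    have : 0 < l * (l ^ 2 + t ^ 2) := by positivity
    exact this.ne'
  rw [intervalIntegral.integral_eq_sub_of_hasDerivAt (fun t _ ↦ hderiv t)
    (hcont.intervalIntegrable _ _)]
  simp

/-- Integrating `ψ(1/4) + Σ_{m<K} f_{l_m} ≤ ρ` over `[0, T]`: for `T ≥ 0` and every `K`,
`T ρ(0) + Σ_{m<K} (2T/l_m − 2 arctan(T/l_m)) ≤ ∫_0^T ρ`. [folklore] -/
theorem partialSum_le_integral {T : ℝ} (hT : 0 ≤ T) (K : ℕ) :
    T * reDigammaQuarter 0 +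
        ∑ m ∈ Finset.range K, (2 * T / digammaNode m - 2 * Real.arctan (T / digammaNode m)) ≤
      ∫ t in (0 : ℝ)..T, reDigammaQuarter t := by
  have hcont : ∀ m : ℕ, Continuous fun t : ℝ ↦ digammaTerm (digammaNode m) t := by
    intro m
    have hl := digammaNode_pos m
    unfold digammaTerm
    refine Continuous.div (by fun_prop) (by fun_prop) fun t ↦ ?_
    have : 0 < digammaNode m * (digammaNode m ^ 2 + t ^ 2) := by positivity
    exact this.ne'
  have hsumc : Continuous fun t : ℝ ↦
      reDigammaQuarter 0 + ∑ m ∈ Finset.range K, digammaTerm (digammaNode m) t :=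
    continuous_const.add (continuous_finsetSum _ fun m _ ↦ hcont m)
  have hval : ∫ t in (0 : ℝ)..T,
      (reDigammaQuarter 0 + ∑ m ∈ Finset.range K, digammaTerm (digammaNode m) t) =
      T * reDigammaQuarter 0 +
        ∑ m ∈ Finset.range K, (2 * T / digammaNode m - 2 * Real.arctan (T / digammaNode m)) := by
    rw [intervalIntegral.integral_add intervalIntegrable_const
        ((continuous_finsetSum _ fun m _ ↦ hcont m).intervalIntegrable _ _),
      intervalIntegral.integral_const, smul_eq_mul, sub_zero,
      intervalIntegral.integral_finsetSum fun m _ ↦ (hcont m).intervalIntegrable _ _]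
    congr 1
    exact Finset.sum_congr rfl fun m _ ↦ integral_digammaTerm (digammaNode_pos m) T
  rw [← hval]
  exact intervalIntegral.integral_mono_on hT (hsumc.intervalIntegrable _ _)
    (continuous_reDigammaQuarter.intervalIntegrable _ _) fun t _ ↦ sum_digammaTerm_le K t

/-! ### The digamma integral -/

/-- For every `k` (with `x = k + 5/4`, `l_{k+1} − 1 = 2x − 1`):
`T ψ(x) − 2 arctan(2T) − (A(2x − 1) − A(3/2)) ≤ ∫_0^T ρ` (`T ≥ 0`): the integrated partial sum,
the recurrence `ψ(1/4) + Σ_{m ≤ k} 1/(m + 1/4) = ψ(x)`, and Jensen for the arctangents. [folklore] -/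
theorem core_le_integral {T : ℝ} (hT : 0 ≤ T) (k : ℕ) :
    T * (Complex.digamma ((1 / 4 + ((k + 1 : ℕ) : ℝ) : ℝ) : ℂ)).re -
        2 * Real.arctan (T / digammaNode 0) -
        (((digammaNode (k + 1) - 1) * Real.arctan (T / (digammaNode (k + 1) - 1)) +
            T / 2 * Real.log ((digammaNode (k + 1) - 1) ^ 2 + T ^ 2)) -
          (3 / 2 * Real.arctan (T / (3 / 2)) + T / 2 * Real.log ((3 / 2) ^ 2 + T ^ 2))) ≤
      ∫ t in (0 : ℝ)..T, reDigammaQuarter t := by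
  have h1 := partialSum_le_integral hT (k + 1)
  rw [Finset.sum_sub_distrib] at h1
  -- the harmonic part is `T (ψ(x) − ψ(1/4))`
  have hharm : ∑ m ∈ Finset.range (k + 1), 2 * T / digammaNode m =
      T * ∑ j ∈ Finset.range (k + 1), 1 / (1 / 4 + (j : ℝ)) := by
    rw [Finset.mul_sum]
    refine Finset.sum_congr rfl fun m _ ↦ ?_
    have hm : (0 : ℝ) ≤ m := Nat.cast_nonneg m
    unfold digammaNode
    field_simp
    ring
  have hpsi : (Complex.digamma ((1 / 4 + ((k + 1 : ℕ) : ℝ) : ℝ) : ℂ)).re =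
      reDigammaQuarter 0 + ∑ j ∈ Finset.range (k + 1), 1 / (1 / 4 + (j : ℝ)) := by
    rw [reDigammaQuarter_zero]
    have h := re_digamma_add_nat (x := 1 / 4) (by norm_num) (k + 1)
    have e1 : (((1 / 4 : ℝ)) : ℂ) + ((k + 1 : ℕ) : ℂ) = (((1 / 4 + ((k + 1 : ℕ) : ℝ) : ℝ)) : ℂ) := by
      push_cast; ring
    have e2 : (((1 / 4 : ℝ)) : ℂ) = 1 / 4 := by push_cast; ring
    rw [e1, e2] at h
    exact h
  -- Jensen for the arctangent sum
  have harc : ∑ m ∈ Finset.range (k + 1), 2 * Real.arctan (T / digammaNode m) =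
      (∑ i ∈ Finset.range k, 2 * Real.arctan (T / digammaNode (i + 1))) +
        2 * Real.arctan (T / digammaNode 0) := Finset.sum_range_succ' _ _
  have hJ := sum_arctan_div_le hT k
  have hmain : T * (Complex.digamma ((1 / 4 + ((k + 1 : ℕ) : ℝ) : ℝ) : ℂ)).re =
      T * reDigammaQuarter 0 + ∑ m ∈ Finset.range (k + 1), 2 * T / digammaNode m := by
    rw [hharm, hpsi]; ring
  linarith

/-- The elementary bookkeeping: for `T ≥ 2` and `x ≥ T³`,
`T (log(T/2) − 1) − 21/5 ≤ T (log x − 1/(2x) − 1/(12x²)) − π − (A(2x−1) − A(3/2))`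
(`arctan y ≤ y`, `log(1+y) ≤ y`, `arctan(4/3) ≥ π/4`, `π ≤ 4`). [folklore] -/
theorem core_lower {T x : ℝ} (hT : 2 ≤ T) (hxK : T ^ 3 ≤ x) :
    T * (Real.log (T / 2) - 1) - 21 / 5 ≤
      T * (Real.log x - 1 / (2 * x) - 1 / (12 * x ^ 2)) - Real.pi -
        (((2 * x - 1) * Real.arctan (T / (2 * x - 1)) + T / 2 * Real.log ((2 * x - 1) ^ 2 + T ^ 2)) -
          (3 / 2 * Real.arctan (T / (3 / 2)) + T / 2 * Real.log ((3 / 2) ^ 2 + T ^ 2))) := by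
  have hT0 : 0 < T := by linarith
  have hT2 : 4 ≤ T ^ 2 := by nlinarith
  have hT3 : 8 ≤ T ^ 3 := by
    have h := pow_le_pow_left₀ (by norm_num : (0 : ℝ) ≤ 2) hT 3
    norm_num at h
    exact h
  have h4T : 4 * T ≤ T ^ 3 := by nlinarith [mul_nonneg hT0.le (sub_nonneg.2 hT2)]
  have hx8 : 8 ≤ x := hT3.trans hxK
  have hx0 : 0 < x := by linarith
  set y : ℝ := 2 * x - 1 with hy
  have hyT : T ^ 3 ≤ y := by rw [hy]; linarith
  have hy8 : 8 ≤ y := hT3.trans hyT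
  have hy0 : 0 < y := by linarith
  -- (a) `y arctan(T/y) ≤ T`
  have ha : y * Real.arctan (T / y) ≤ T := by
    -- `arctan u ≤ u` for `u ≥ 0` (as `Literature.NumberTheory.LFunctions.arctan_le_self`)
    have hat : Real.arctan (T / y) ≤ T / y := by
      have h := Real.le_tan (Real.arctan_nonneg.2 (by positivity : (0 : ℝ) ≤ T / y))
        (Real.arctan_lt_pi_div_two (T / y))
      rwa [Real.tan_arctan] at h
    have h := mul_le_mul_of_nonneg_left hat hy0.le
    have e : y * (T / y) = T := by field_simp
    linarith
  -- (b) `(T/2) log(y² + T²) ≤ T log y + T³/(2y²)`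
  have hb : T / 2 * Real.log (y ^ 2 + T ^ 2) ≤ T * Real.log y + T ^ 3 / (2 * y ^ 2) := by
    have hy2 : 0 < y ^ 2 := by positivity
    have hz : 0 < 1 + T ^ 2 / y ^ 2 := by positivity
    have e : y ^ 2 + T ^ 2 = y ^ 2 * (1 + T ^ 2 / y ^ 2) := by field_simp
    rw [e, Real.log_mul hy2.ne' hz.ne', Real.log_pow]
    have hlog := Real.log_le_sub_one_of_pos hz
    have h := mul_le_mul_of_nonneg_left hlog (by positivity : 0 ≤ T / 2)
    have e2 : T / 2 * (1 + T ^ 2 / y ^ 2 - 1) = T ^ 3 / (2 * y ^ 2) := by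
      field_simp
      ring
    have e3 : T / 2 * ((2 : ℕ) * Real.log y + Real.log (1 + T ^ 2 / y ^ 2)) =
        T * Real.log y + T / 2 * Real.log (1 + T ^ 2 / y ^ 2) := by push_cast; ring
    linarith
  -- (c) `log y ≤ log 2 + log x`
  have hc : Real.log y ≤ Real.log 2 + Real.log x := by
    rw [← Real.log_mul two_ne_zero hx0.ne']
    exact Real.log_le_log hy0 (by linarith)
  -- (e) `(3/2) arctan(2T/3) ≥ 3π/8`
  have he : 3 / 2 * (Real.pi / 4) ≤ 3 / 2 * Real.arctan (T / (3 / 2)) := by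
    rw [← Real.arctan_one]
    have h1 : (1 : ℝ) ≤ T / (3 / 2) := by rw [le_div_iff₀ (by norm_num)]; linarith
    have := Real.arctan_le_arctan_iff.2 h1
    linarith
  -- (f) `(T/2) log(9/4 + T²) ≥ T log T`
  have hf : T * Real.log T ≤ T / 2 * Real.log ((3 / 2) ^ 2 + T ^ 2) := by
    have h1 : Real.log (T ^ 2) ≤ Real.log ((3 / 2) ^ 2 + T ^ 2) :=
      Real.log_le_log (by positivity) (by nlinarith)
    rw [Real.log_pow] at h1
    push_cast at h1
    have h2 := mul_le_mul_of_nonneg_left h1 (by positivity : 0 ≤ T / 2)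
    have e : T / 2 * (2 * Real.log T) = T * Real.log T := by ring
    linarith
  -- (g) the three error terms
  have hg1 : T / (2 * x) ≤ 1 / 8 := by
    rw [div_le_iff₀ (by positivity)]
    linarith
  have hg2 : T / (12 * x ^ 2) ≤ 1 / 8 := by
    rw [div_le_iff₀ (by positivity)]
    have hxx : 8 * x ≤ x ^ 2 := by nlinarith
    linarith
  have hg3 : T ^ 3 / (2 * y ^ 2) ≤ 1 / 16 := by
    rw [div_le_iff₀ (by positivity)]
    have hyy : T ^ 3 * y ≤ y ^ 2 := by nlinarith
    have h8 : 8 * T ^ 3 ≤ T ^ 3 * y := by nlinarith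
    linarith
  -- (h) `log(T/2) = log T − log 2`, `π ≤ 4`
  have hh : Real.log (T / 2) = Real.log T - Real.log 2 := Real.log_div hT0.ne' two_ne_zero
  have hpi := Real.pi_le_four
  -- bookkeeping: expand the products with `T`
  have e1 : T * (Real.log x - 1 / (2 * x) - 1 / (12 * x ^ 2)) =
      T * Real.log x - T / (2 * x) - T / (12 * x ^ 2) := by ring
  have hTlog := mul_le_mul_of_nonneg_left hc hT0.le
  have e2 : T * (Real.log 2 + Real.log x) = T * Real.log 2 + T * Real.log x := by ring
  have e3 : T * (Real.log (T / 2) - 1) = T * Real.log T - T * Real.log 2 - T := by rw [hh]; ring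
  rw [e3, e1]
  linarith

/-- **Convexity bound for the digamma integral (half line).** For `T ≥ 2`:
`T (log(T/2) − 1) − 21/5 ≤ ∫_0^T Re ψ(1/4 + it/2) dt` (take `K = k + 1 > T³` terms). [folklore] -/
theorem integral_reDigammaQuarter_half_ge {T : ℝ} (hT : 2 ≤ T) :
    T * (Real.log (T / 2) - 1) - 21 / 5 ≤ ∫ t in (0 : ℝ)..T, reDigammaQuarter t := by
  have hT0 : 0 < T := by linarith
  obtain ⟨k, hk⟩ : ∃ k : ℕ, T ^ 3 ≤ (k : ℝ) := exists_nat_ge (T ^ 3)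
  have h1 := core_le_integral hT0.le k
  have hxK : T ^ 3 ≤ 1 / 4 + ((k + 1 : ℕ) : ℝ) := by push_cast; linarith
  have h2 := core_lower hT hxK
  have hx0 : 0 < 1 / 4 + ((k + 1 : ℕ) : ℝ) := by positivity
  have hst := Literature.Analysis.SpecialFunctions.Real.log_sub_le_re_digamma hx0
  have hst' := mul_le_mul_of_nonneg_left hst hT0.le
  have hl : digammaNode (k + 1) - 1 = 2 * (1 / 4 + ((k + 1 : ℕ) : ℝ)) - 1 := by
    unfold digammaNode; push_cast; ring
  rw [hl] at h1
  have hd : 2 * Real.arctan (T / digammaNode 0) ≤ Real.pi := by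
    have := Real.arctan_lt_pi_div_two (T / digammaNode 0)
    linarith
  linarith

/-- Registered sub-goal form of `integral_reDigammaQuarter_half_ge` (siege k3 helper for
`stub_archBathtub`): for `T ≥ 2`, `T (log(T/2) − 1) − 21/5 ≤ ∫_0^T Re ψ(1/4 + it/2) dt`. [folklore] -/
theorem stub_archBathtubK3_digammaIntegral : ∀ T : ℝ, 2 ≤ T →
    T * (Real.log (T / 2) - 1) - 21 / 5 ≤ ∫ t in (0 : ℝ)..T, reDigammaQuarter t :=
  fun _ hT ↦ integral_reDigammaQuarter_half_ge hT

end Summit.RiemannHypothesis.RiemannHypothesis.Theorems.WeilCombBohrFejerJensenK3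

end
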